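import Literature.Algebra.Homology.OrderedCechPairSystemShuffle
import Literature.Algebra.Homology.OrderedCechSystemAlternatingDifferential
import Literature.Algebra.Homology.OrderedCechPairSystemBounds
import Mathlib.Algebra.BigOperators.Fin
import Mathlib.Tactic.Abel
import Mathlib.Tactic.Ring
import HarnessLib

/-!
# The cross product `× : Tot Č•,•(P) ⟶ Č(lexSystem P)` (Alexander–Whitney) is a morphism of complexes
# (Eilenberg–Mac Lane 1953 §5; The Stacks Project, Tag 0BEC)

Layer `Literature/Algebra/Homology`, PROOF lane (theorems only; no definition, no instance, no notation, no named fact).  For a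
pair-system `P : Finset ι ⥤ Finset κ ⥤ ModuleCat A` the components `crossComponent P a b n : Čᵃᵇ(P) →ₗ Čⁿ(lexSystem P)`
(`Algebra/Homology/OrderedCechPairSystemShuffle` §4: `(× x)(w₀ < ⋯ < w_n) = x(π₂-word of the back b-face)(π₁-word of the front a-face)|`,
both words through the alternating evaluation) satisfy the compatibility **`crossComponent_comm`**:
`×_{a,b} ≫ d = d₁ ≫ ×_{a+1,b} + (-1)ᵃ • d₂ ≫ ×_{a,b+1}` — exactly the hypothesis of the constructor `totalDescHom`, so that
`totalDescHom (sysBicomplex P) (sysComplex (lexSystem P)) (fun a b n => ofHom (crossComponent P a b n)) (crossComponent_comm P)` IS the cross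
product as a morphism of cochain complexes (`cross_totalDescHom_f`).  PROOF (§3): the `k`-th face of an `(n+1)`-chain `w₀ < ⋯ < w_{n+1}` has front
word `w ∘ δ_k|_{≤ a}` and back word `w ∘ δ_k|_{≥ a}`; for `k ≤ a` this is the `k`-th term of the `σ`-differential of `x` read at
`(w₀…w_{a+1} ; w_{a+1}…w_{n+1})` (the full cosimplicial formula `altEvalAt_sysD` of `Algebra/Homology/OrderedCechSystemAlternatingDifferential`
in the `ι`-variable), for `k ≥ a+1` the `(k-a)`-th term of the `τ`-differential read at `(w₀…w_a ; w_a…w_{n+1})` (the same formula in the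
`κ`-variable), and the two left-over terms (`σ`-index `a+1`, `τ`-index `0`) cancel.  No non-degeneracy case analysis is needed: the alternating
evaluation vanishes on repeated letters.

Cell `hodgecm-mathlib` (D-0151), F-11 / J3 Künneth packet, brick (K2-b) of F0P1b-p04's plan (RULINGS #3 (R15), #4 (R20)).  HC_CM is proved only modulo
the 7 printed citations until rung 0 closes — nothing here bears on a summit statement.

## References
* S. Eilenberg, S. Mac Lane, *On the groups `H(Π,n)`, I*, Ann. of Math. 58 (1953), §5 (the map `f × g`). [EilenbergMacLane1953]
* The Stacks Project, Tag 0BEC, Tag 012K, Tag 01FG. [StacksProject]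
* U. Görtz, T. Wedhorn, *Algebraic Geometry II* (2023), Def. 21.64, Def. 21.68 (pp. 179–180). [GortzWedhorn2023]
-/

universe u

open CategoryTheory CategoryTheory.Limits HomologicalComplex

set_option backward.isDefEq.respectTransparency false

noncomputable section

namespace Literature.Algebra.Homology

namespace OrderedCech

variable {A : Type u} [CommRing A] {ι κ : Type} [LinearOrder ι] [LinearOrder κ]
  (P : Finset ι ⥤ Finset κ ⥤ ModuleCat.{u} A)

/-! ### §1 Tools: positions, alternating evaluation vs. maps and sums, restriction of a double reading -/

omit [LinearOrder ι] [LinearOrder κ] in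
/-- The value of `δ_p(i)` (`Fin.succAbove`): `i` if `i < p`, else `i + 1`. [folklore] -/
private theorem val_succAbove {m : ℕ} (p : Fin (m + 1)) (i : Fin m) :
    ((p.succAbove i : Fin (m + 1)) : ℕ) = if (i : ℕ) < p then (i : ℕ) else i + 1 := by
  by_cases h : (i : ℕ) < p
  · rw [if_pos h, Fin.succAbove_of_castSucc_lt _ _ (Fin.lt_def.mpr (by simpa using h)), Fin.val_castSucc]
  · rw [if_neg h, Fin.succAbove_of_le_castSucc _ _ (Fin.le_def.mpr (by simpa using Nat.le_of_not_lt h)), Fin.val_succ]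

section OneSystem

variable {ι' : Type} [LinearOrder ι'] {M M' : Finset ι' ⥤ ModuleCat.{u} A} {n : ℤ} {m : ℕ}

omit [LinearOrder ι] [LinearOrder κ] in
/-- The alternating evaluation commutes with maps of systems. [cite: StacksProject, Tag 01FG] -/
theorem SysCochain.altEvalAt_sysCochainMap (φ : M ⟶ M') (g : SysCochain M n) (β : Fin m → ι') (t : Finset ι') :
    (sysCochainMap φ n g).altEvalAt β t = (φ.app t).hom (g.altEvalAt β t) := by
  classical
  by_cases hβ : Function.Injective β
  · rw [SysCochain.altEvalAt_of_injective _ hβ, SysCochain.altEvalAt_of_injective _ hβ, ext0At_sysCochainMap, map_smul]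
  · rw [SysCochain.altEvalAt_of_not_injective _ hβ, SysCochain.altEvalAt_of_not_injective _ hβ, map_zero]

omit [LinearOrder ι] [LinearOrder κ] in
/-- The alternating evaluation of the zero cochain. [cite: StacksProject, Tag 01FG] -/
theorem SysCochain.altEvalAt_zero (β : Fin m → ι') (t : Finset ι') : (0 : SysCochain M n).altEvalAt β t = 0 := by
  have h := SysCochain.altEvalAt_smul (0 : A) (0 : SysCochain M n) β t
  rwa [zero_smul, zero_smul] at h

omit [LinearOrder ι] [LinearOrder κ] in
/-- The alternating evaluation of a sum of cochains. [cite: StacksProject, Tag 01FG] -/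
theorem SysCochain.altEvalAt_sum {γ : Type*} (S : Finset γ) (f : γ → SysCochain M n) (β : Fin m → ι') (t : Finset ι') :
    (∑ c ∈ S, f c).altEvalAt β t = ∑ c ∈ S, (f c).altEvalAt β t := by
  classical
  induction S using Finset.induction_on with
  | empty => rw [Finset.sum_empty, Finset.sum_empty, SysCochain.altEvalAt_zero]
  | insert c S hc ih => rw [Finset.sum_insert hc, Finset.sum_insert hc, SysCochain.altEvalAt_add, ih]

omit [LinearOrder ι] [LinearOrder κ] in
/-- The ordered Čech differential summed over POSITIONS: `(d y)_σ = Σ_k (-1)^k • y.ext0At (σ ∖ e_k) σ` (`e` the sorted enumeration).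
[cite: GortzWedhorn2023, Def. 21.68 (p. 180)] [cite: StacksProject, Tag 01FG] -/
theorem sysD_apply_orderEmbOfFin (y : SysCochain M n) (σ : Simplex ι' (n + 1)) {c : ℕ} (hc : σ.1.card = c) :
    sysD M n y σ = ∑ k : Fin c, (-1 : A) ^ (k : ℕ) • y.ext0At (σ.1.erase (σ.1.orderEmbOfFin hc k)) σ.1 := by
  rw [sysD_apply, sum_eq_sum_orderEmbOfFin σ.1 hc]
  refine Finset.sum_congr rfl fun k _ => ?_
  rw [sign_orderEmbOfFin]

end OneSystem

/-- The letters of the front word lie in `π₁T`. [cite: EilenbergMacLane1953, §5] -/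
theorem image_frontWord_subset (T : Finset (ι ×ₗ κ)) {a b : ℕ} (h : T.card = a + b + 1) :
    Finset.univ.image (frontWord T h) ⊆ fstProj T := by
  intro i hi
  obtain ⟨k, -, rfl⟩ := Finset.mem_image.mp hi
  exact fst_mem_fstProj (Finset.orderEmbOfFin_mem T h _)

/-- The letters of the back word lie in `π₂T`. [cite: EilenbergMacLane1953, §5] -/
theorem image_backWord_subset (T : Finset (ι ×ₗ κ)) {a b : ℕ} (h : T.card = a + b + 1) :
    Finset.univ.image (backWord T h) ⊆ sndProj T := by
  intro j hj
  obtain ⟨k, -, rfl⟩ := Finset.mem_image.mp hj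
  exact snd_mem_sndProj (Finset.orderEmbOfFin_mem T h _)

variable {P}

/-- **Restriction of a double reading**: `pairRestrict (x.crossRead α β s t) = x.crossRead α β s' t'` when the letters of `α`, `β` lie in
`s`, `t`. [cite: EilenbergMacLane1953, §5] [cite: StacksProject, Tag 01FG] -/
theorem SysCochain.pairRestrict_crossRead {a b : ℤ} (x : SysCochain (cochainSystem P a) b) {p q : ℕ} (α : Fin p → ι)
    (β : Fin q → κ) {s s' : Finset ι} {t t' : Finset κ} (hs : s ⊆ s') (ht : t ⊆ t') (hα : Finset.univ.image α ⊆ s)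
    (hβ : Finset.univ.image β ⊆ t) :
    (pairRestrict P hs ht).hom (x.crossRead α β s t) = x.crossRead α β s' t' := by
  unfold SysCochain.crossRead pairRestrict
  rw [ModuleCat.comp_apply]
  have e1 : ((P.map (homOfLE hs)).app t).hom (SysCochain.altEvalAt (M := P.flip.obj t) (x.altEvalAt β t) α s) =
      SysCochain.altEvalAt (M := P.flip.obj t) (x.altEvalAt β t) α s' :=
    SysCochain.map_altEvalAt (M := P.flip.obj t) _ α s s' hα hs
  rw [e1, ← SysCochain.map_altEvalAt (M := cochainSystem P a) x β t t' hβ ht, cochainSystem_map_apply,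
    SysCochain.altEvalAt_sysCochainMap]
  rfl

/-- **The `σ`-differential read twice**: `(d₁ x).crossRead α β = Σ_i (-1)^i • x.crossRead (α ∘ δ_i) β` (the full cosimplicial formula
`altEvalAt_sysD` in the `ι`-variable). [cite: StacksProject, Tag 01FG] [cite: EilenbergMacLane1953, §5] -/
theorem SysCochain.crossRead_d₁ {a b : ℤ} (x : SysCochain (cochainSystem P a) b) {p q : ℕ} (α : Fin (p + 2) → ι)
    (β : Fin q → κ) (s : Finset ι) (t : Finset κ) (hα : Finset.univ.image α ⊆ s) :
    (sysCochainMap (cochainSystemD P a) b x).crossRead α β s t =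
      ∑ i : Fin (p + 2), (-1 : A) ^ (i : ℕ) • x.crossRead (α ∘ i.succAbove) β s t := by
  unfold SysCochain.crossRead
  rw [SysCochain.altEvalAt_sysCochainMap, cochainSystemD_app_apply]
  exact SysCochain.altEvalAt_sysD (M := P.flip.obj t) _ α s hα

/-- **The `τ`-differential read twice**: `(d₂ x).crossRead α β = Σ_j (-1)^j • x.crossRead α (β ∘ δ_j)` (the same formula in the
`κ`-variable, then linearity of the outer evaluation). [cite: StacksProject, Tag 01FG] [cite: EilenbergMacLane1953, §5] -/
theorem SysCochain.crossRead_d₂ {a b : ℤ} (x : SysCochain (cochainSystem P a) b) {p q : ℕ} (α : Fin p → ι)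
    (β : Fin (q + 2) → κ) (s : Finset ι) (t : Finset κ) (hβ : Finset.univ.image β ⊆ t) :
    (sysD (cochainSystem P a) b x).crossRead α β s t =
      ∑ j : Fin (q + 2), (-1 : A) ^ (j : ℕ) • x.crossRead α (β ∘ j.succAbove) s t := by
  unfold SysCochain.crossRead
  rw [SysCochain.altEvalAt_sysD (cochainSystem P a) x β t hβ]
  rw [SysCochain.altEvalAt_sum (M := P.flip.obj t)]
  refine Finset.sum_congr rfl fun j _ => ?_
  rw [SysCochain.altEvalAt_smul]

/-! ### §2 The faces of a chain of `ι ×ₗ κ`: the cross product of `x` read on the `k`-th face -/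

omit [LinearOrder ι] [LinearOrder κ] in
/-- The sorted enumeration does not depend on how its length is written. [folklore] -/
private theorem orderEmbOfFin_congr {X : Type*} [LinearOrder X] (s : Finset X) {c c' : ℕ} (h : s.card = c)
    (h' : s.card = c') (k : Fin c) (k' : Fin c') (hk : (k : ℕ) = k') : s.orderEmbOfFin h k = s.orderEmbOfFin h' k' := by
  obtain rfl : c = c' := h.symm.trans h'
  rw [Fin.ext hk]

/-- **The `k`-th face term of `d(× x)`**: for an `(a+b+1)`-chain `T'` with sorted enumeration `e` on `(a+1)+(b+1)` positions, the value
of `× x` on the face `T' ∖ e_k`, restricted to `P (π₁T') (π₂T')`, is the double reading of `x` at the words `(e ∘ δ_k)|_{0..a}` (first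
coordinates) and `(e ∘ δ_k)|_{a..a+b}` (second coordinates). [cite: EilenbergMacLane1953, §5] [cite: StacksProject, Tag 0BEC] -/
theorem crossComponent_ext0At_face (a b : ℕ) (x : SysCochain (cochainSystem P a) b) (T' : Simplex (ι ×ₗ κ) ((a : ℤ) + b + 1))
    (hc : T'.1.card = (a + 1) + (b + 1)) (k : Fin ((a + 1) + (b + 1))) :
    (crossComponent P a b ((a : ℤ) + b) x).ext0At (T'.1.erase (T'.1.orderEmbOfFin hc k)) T'.1 =
      x.crossRead (fun i : Fin (a + 1) => (ofLex (T'.1.orderEmbOfFin hc (k.succAbove (⟨i, by omega⟩ : Fin ((a + 1) + b))))).1)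
        (fun j : Fin (b + 1) => (ofLex (T'.1.orderEmbOfFin hc (k.succAbove (⟨a + j, by omega⟩ : Fin ((a + 1) + b))))).2)
        (fstProj T'.1) (sndProj T'.1) := by
  have hmem := Finset.orderEmbOfFin_mem T'.1 hc k
  have hcard : (T'.1.erase (T'.1.orderEmbOfFin hc k)).card = (a + 1) + b := by
    have h1 := Finset.card_erase_of_mem hmem; omega
  have hF : (T'.1.erase (T'.1.orderEmbOfFin hc k)).Nonempty ∧
      (((T'.1.erase (T'.1.orderEmbOfFin hc k)).card : ℤ)) = (a : ℤ) + b + 1 :=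
    ⟨Finset.card_pos.mp (by omega), by push_cast [hcard]; ring⟩
  have hr : 0 ≤ (a : ℤ) ∧ 0 ≤ (b : ℤ) ∧ (a : ℤ) + b = (a : ℤ) + b := ⟨by omega, by omega, rfl⟩
  rw [SysCochain.ext0At_val (M := lexSystem P) _ ⟨_, hF⟩ T'.1 (Finset.erase_subset _ _), lexSystem_map_eq_pairRestrict,
    crossComponent_apply_of P hr]
  unfold crossValue
  dsimp only
  refine Eq.trans (SysCochain.pairRestrict_crossRead x _ _ _ _ (image_frontWord_subset _ _) (image_backWord_subset _ _)) ?_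
  -- the face is enumerated by `e ∘ δ_k`
  have henum : ∀ z : Fin ((a + 1) + b),
      (T'.1.erase (T'.1.orderEmbOfFin hc k)).orderEmbOfFin hcard z = T'.1.orderEmbOfFin hc (k.succAbove z) :=
    fun z => congrFun (orderEmbOfFin_erase T'.1 hc k hcard) z
  unfold frontWord backWord
  congr 1
  · funext i
    rw [orderEmbOfFin_congr _ (crossCard hr ⟨_, hF⟩) hcard _ (⟨i, by omega⟩ : Fin ((a + 1) + b)) (by simp), henum]
  · funext j
    rw [orderEmbOfFin_congr _ (crossCard hr ⟨_, hF⟩) hcard _ (⟨a + j, by omega⟩ : Fin ((a + 1) + b)) (by simp), henum]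

/-! ### §3 The cochain-map property -/

/-- **Core identity, natural-number degrees**: `d(×_{a,b} x) = ×_{a+1,b}(d₁ x) + (-1)ᵃ • ×_{a,b+1}(d₂ x)` on every `(a+b+1)`-chain.
[cite: EilenbergMacLane1953, §5] [cite: StacksProject, Tag 0BEC] -/
theorem sysD_crossComponent_nat (a b : ℕ) (x : SysCochain (cochainSystem P a) b) (T' : Simplex (ι ×ₗ κ) ((a : ℤ) + b + 1)) :
    sysD (lexSystem P) ((a : ℤ) + b) (crossComponent P a b ((a : ℤ) + b) x) T' =
      crossComponent P ((a : ℤ) + 1) b ((a : ℤ) + b + 1) (sysCochainMap (cochainSystemD P a) b x) T' +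
        (-1 : A) ^ a • crossComponent P a ((b : ℤ) + 1) ((a : ℤ) + b + 1) (sysD (cochainSystem P a) b x) T' := by
  -- the sorted enumeration of `T'`, on `(a+1)+(b+1)` positions, and the two readings of `T'`
  have hc : T'.1.card = (a + 1) + (b + 1) := by have := T'.2.2; omega
  have h₁ : T'.1.card = (a + 1) + b + 1 := by omega
  have h₂ : T'.1.card = a + (b + 1) + 1 := by omega
  have hr₁ : 0 ≤ (a : ℤ) + 1 ∧ 0 ≤ (b : ℤ) ∧ (a : ℤ) + 1 + b = (a : ℤ) + b + 1 := ⟨by omega, by omega, by omega⟩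
  have hr₂ : 0 ≤ (a : ℤ) ∧ 0 ≤ (b : ℤ) + 1 ∧ (a : ℤ) + (b + 1) = (a : ℤ) + b + 1 := ⟨by omega, by omega, by omega⟩
  -- LHS over positions, each face read twice; RHS the two differentials read twice
  rw [sysD_apply_orderEmbOfFin (M := lexSystem P) _ T' hc,
    Finset.sum_congr rfl fun k _ => by rw [crossComponent_ext0At_face a b x T' hc k],
    crossComponent_apply_of P hr₁, crossComponent_apply_of P hr₂]
  change _ = (sysCochainMap (cochainSystemD P a) b x).crossRead (frontWord T'.1 h₁) (backWord T'.1 h₁)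
      (fstProj T'.1) (sndProj T'.1) +
    (-1 : A) ^ a • (sysD (cochainSystem P a) b x).crossRead (frontWord T'.1 h₂) (backWord T'.1 h₂)
      (fstProj T'.1) (sndProj T'.1)
  rw [SysCochain.crossRead_d₁ x _ _ _ _ (image_frontWord_subset _ h₁),
    SysCochain.crossRead_d₂ x _ _ _ _ (image_backWord_subset _ h₂),
    Fin.sum_univ_add, Fin.sum_univ_castSucc (n := a + 1), Fin.sum_univ_succ (n := b + 1), smul_add, Finset.smul_sum]
  -- (I) faces `k ≤ a` = terms of the `σ`-differential
  have E1 : ∀ m : Fin (a + 1),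
      (-1 : A) ^ ((Fin.castAdd (b + 1) m : Fin ((a + 1) + (b + 1))) : ℕ) •
        x.crossRead (fun i : Fin (a + 1) => (ofLex (T'.1.orderEmbOfFin hc ((Fin.castAdd (b + 1) m).succAbove (⟨i, by omega⟩ : Fin ((a + 1) + b))))).1)
          (fun j : Fin (b + 1) => (ofLex (T'.1.orderEmbOfFin hc ((Fin.castAdd (b + 1) m).succAbove (⟨a + j, by omega⟩ : Fin ((a + 1) + b))))).2)
          (fstProj T'.1) (sndProj T'.1) =
      (-1 : A) ^ ((Fin.castSucc m : Fin (a + 1 + 1)) : ℕ) •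
        x.crossRead (frontWord T'.1 h₁ ∘ (Fin.castSucc m).succAbove) (backWord T'.1 h₁) (fstProj T'.1) (sndProj T'.1) := by
    intro m
    rw [Fin.val_castAdd, Fin.val_castSucc]
    congr 2
    · funext i
      simp only [Function.comp_apply, frontWord]
      congr 2
      apply orderEmbOfFin_congr
      simp only [val_succAbove, Fin.val_castAdd, Fin.val_castSucc]
    · funext j
      simp only [backWord]
      congr 2
      apply orderEmbOfFin_congr
      simp only [val_succAbove, Fin.val_castAdd]
      split_ifs <;> omega
  -- (II) faces `k ≥ a + 1` = terms of the `τ`-differential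
  have E2 : ∀ j : Fin (b + 1),
      (-1 : A) ^ ((Fin.natAdd (a + 1) j : Fin ((a + 1) + (b + 1))) : ℕ) •
        x.crossRead (fun i : Fin (a + 1) => (ofLex (T'.1.orderEmbOfFin hc ((Fin.natAdd (a + 1) j).succAbove (⟨i, by omega⟩ : Fin ((a + 1) + b))))).1)
          (fun j' : Fin (b + 1) => (ofLex (T'.1.orderEmbOfFin hc ((Fin.natAdd (a + 1) j).succAbove (⟨a + j', by omega⟩ : Fin ((a + 1) + b))))).2)
          (fstProj T'.1) (sndProj T'.1) =
      (-1 : A) ^ a • ((-1 : A) ^ ((Fin.succ j : Fin (b + 1 + 1)) : ℕ) •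
        x.crossRead (frontWord T'.1 h₂) (backWord T'.1 h₂ ∘ (Fin.succ j).succAbove) (fstProj T'.1) (sndProj T'.1)) := by
    intro j
    rw [Fin.val_natAdd, Fin.val_succ, smul_smul, ← pow_add, show a + ((j : ℕ) + 1) = a + 1 + j by omega]
    congr 2
    · funext i
      simp only [frontWord]
      congr 2
      apply orderEmbOfFin_congr
      simp only [val_succAbove, Fin.val_natAdd]
      split_ifs <;> omega
    · funext j'
      simp only [Function.comp_apply, backWord]
      congr 2
      apply orderEmbOfFin_congr
      simp only [val_succAbove, Fin.val_natAdd, Fin.val_succ]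
      split_ifs <;> omega
  -- (III) the two left-over terms cancel
  have W5 : frontWord T'.1 h₁ ∘ Fin.castSucc = frontWord T'.1 h₂ := by
    funext i
    simp only [Function.comp_apply, frontWord]
    congr 2
  have W6 : backWord T'.1 h₂ ∘ Fin.succ = backWord T'.1 h₁ := by
    funext j
    simp only [Function.comp_apply, backWord]
    congr 2
    apply orderEmbOfFin_congr
    simp only [Fin.val_succ]
    omega
  have E3 : (-1 : A) ^ ((Fin.last (a + 1) : Fin (a + 1 + 1)) : ℕ) •
        x.crossRead (frontWord T'.1 h₁ ∘ (Fin.last (a + 1)).succAbove) (backWord T'.1 h₁) (fstProj T'.1) (sndProj T'.1) +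
      (-1 : A) ^ a • ((-1 : A) ^ ((0 : Fin (b + 1 + 1)) : ℕ) •
        x.crossRead (frontWord T'.1 h₂) (backWord T'.1 h₂ ∘ (0 : Fin (b + 1 + 1)).succAbove) (fstProj T'.1) (sndProj T'.1)) = 0 := by
    rw [Fin.succAbove_last, Fin.succAbove_zero, W5, W6, Fin.val_last, Fin.val_zero, pow_zero, one_smul, pow_succ, mul_neg_one,
      neg_smul, neg_add_cancel]
  rw [Finset.sum_congr rfl fun m _ => E1 m, Finset.sum_congr rfl fun j _ => E2 j, eq_neg_of_add_eq_zero_left E3]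
  abel

variable (P)

/-- **The cross components commute with the differentials** in the form required by `totalDescHom`:
`×_{a,b} ≫ d = d₁ ≫ ×_{a',b} + (-1)ᵃ • d₂ ≫ ×_{a,b'}` for `n' = n+1`, `a' = a+1`, `b' = b+1`, `a + b = n`. [cite: EilenbergMacLane1953, §5]
[cite: StacksProject, Tag 0BEC] -/
theorem crossComponent_comm (n n' a a' b b' : ℤ) (hn : n + 1 = n') (ha : a + 1 = a') (hb : b + 1 = b') (hab : a + b = n) :
    ModuleCat.ofHom (crossComponent P a b n) ≫ (sysComplex (lexSystem P)).d n n' =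
      ((sysBicomplex P).d a a').f b ≫ ModuleCat.ofHom (crossComponent P a' b n') +
        ((a.negOnePow : ℤˣ) : ℤ) • (((sysBicomplex P).X a).d b b' ≫ ModuleCat.ofHom (crossComponent P a b' n')) := by
  subst hn ha hb hab
  rw [sysComplex_d]
  refine ModuleCat.hom_ext (LinearMap.ext fun x => funext fun T' => ?_)
  change sysD (lexSystem P) (a + b) (crossComponent P a b (a + b) x) T' =
    (crossComponent P (a + 1) b (a + b + 1) ((((sysBicomplex P).d a (a + 1)).f b).hom x) +
      ((a.negOnePow : ℤˣ) : ℤ) • crossComponent P a (b + 1) (a + b + 1) ((((sysBicomplex P).X a).d b (b + 1)).hom x)) T'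
  rw [sysBicomplex_d_f_apply, sysBicomplex_X_d_apply, ← Int.cast_smul_eq_zsmul A]
  change _ = crossComponent P (a + 1) b (a + b + 1) (sysCochainMap (cochainSystemD P a) b x) T' +
    (((a.negOnePow : ℤˣ) : ℤ) : A) • crossComponent P a (b + 1) (a + b + 1) (sysD (cochainSystem P a) b x) T'
  rcases lt_or_ge a 0 with ha | ha
  · haveI : IsEmpty (Simplex ι a) := isEmpty_simplex_of_neg ha
    haveI := subsingleton_sysCochain_cochainSystem P (a := a) b
    obtain rfl : x = 0 := Subsingleton.elim _ _
    simp only [map_zero]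
    change (0 : (lexSystem P).obj T'.1) = (0 : (lexSystem P).obj T'.1) + _ • (0 : (lexSystem P).obj T'.1)
    rw [smul_zero, add_zero]
  rcases lt_or_ge b 0 with hb | hb
  · haveI : IsEmpty (Simplex κ b) := isEmpty_simplex_of_neg hb
    obtain rfl : x = 0 := Subsingleton.elim (α := SysCochain (cochainSystem P a) b) _ _
    simp only [map_zero]
    change (0 : (lexSystem P).obj T'.1) = (0 : (lexSystem P).obj T'.1) + _ • (0 : (lexSystem P).obj T'.1)
    rw [smul_zero, add_zero]
  obtain ⟨a₀, rfl⟩ := Int.eq_ofNat_of_zero_le ha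
  obtain ⟨b₀, rfl⟩ := Int.eq_ofNat_of_zero_le hb
  rw [Int.cast_negOnePow_natCast]
  exact sysD_crossComponent_nat a₀ b₀ x T'

/-- **The cross product `× : Tot Č•,•(P) ⟶ Č(lexSystem P)` exists as a morphism of complexes** (`totalDescHom` applies to the cross
components, `crossComponent_comm`); stated as the characterization `ι_{a,b} ≫ ×_n = ofHom (crossComponent P a b n)` of its parts.
[cite: EilenbergMacLane1953, §5] [cite: StacksProject, Tag 0BEC] -/
theorem ιTotal_cross_f (a b n : ℤ) (h : ComplexShape.π (ComplexShape.up ℤ) (ComplexShape.up ℤ) (ComplexShape.up ℤ) (a, b) = n) :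
    (sysBicomplex P).ιTotal (ComplexShape.up ℤ) a b n h ≫
      (totalDescHom (sysBicomplex P) (sysComplex (lexSystem P)) (fun a b n => ModuleCat.ofHom (crossComponent P a b n))
        (crossComponent_comm P)).f n = ModuleCat.ofHom (crossComponent P a b n) :=
  ιTotal_totalDescHom_f _ _ _ _ a b n h

end OrderedCech

end Literature.Algebra.Homology

end
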